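import Mathlib
import Summits.NavierStokesRegularity.OSWSelfSimilar.TypeIIInnerLimitCaseBZoom
import Summits.NavierStokesRegularity.NavierStokesRegularity.Theorems.AxisymmetricLiouvilleBoundedSwirl
import HarnessLib
/-!
# The inner-limit dichotomy (I-4) by decl: type (β) ⇔ a counterexample to (AX-L) (zone Z1 TEMPLATE §T1.4-I, kernel)

HONEST FRAMING (cell ns-blowup GROUP B «PROFILE SEARCH», zone Z1; D-0035/D-0074): part XVI of the Z1 dictionary. TEMPLATE
(I-4): «every velocity-sup inner limit W of an axisymmetric blow-up is EITHER (α) a constant … OR (β) a NON-CONSTANT bounded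
ancient mild solution, axisymmetric, with bounded swirl — i.e. a COUNTEREXAMPLE to the open Liouville problem (AX-L) …
THIS is the NO-GO hypothesis Z1 lives on»; census line «conjecture instance ¬`AxisymmetricLiouvilleBoundedSwirl`». With
parts XI/XII (the swirl bound survives the limit), XIV/XV (Case B ⇒ constant, kernel) in the tree, this file writes the
dichotomy itself as implications against the CANONICAL conjecture leaf
`Summit.NavierStokesRegularity.NavierStokesRegularity.AxisymmetricLiouvilleBoundedSwirl`:

* `isAxisymmetric_of_tendsto` — axisymmetry is closed under pointwise limits (the Case-A inner object of a zoom with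
  centres ON the axis is axisymmetric);
* `innerLimit_apply_eq_of_axisymmetricLiouville` — **IF (AX-L) holds, every Case-A inner object (KNSS blow-up limit,
  axisymmetric, bounded swirl) is constant in space on every slice** (the conjecture's a.e. conclusion, upgraded by the
  smoothness of `IsKNSSBlowupLimit`);
* `not_axisymmetricLiouville_of_innerLimit_typeBeta` — **contrapositive, the census sentence by decl: a type-(β) inner
  object (one non-constant slice) REFUTES (AX-L)** — `violates:` ¬`AxisymmetricLiouvilleBoundedSwirl` as a kernel
  implication, not a label;
* `innerLimit_apply_eq_under_axisymmetricLiouville` — **the whole (I-3)/(I-4) dichotomy closed under the conjecture**: if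
  (AX-L) holds, an inner object that is EITHER Case A (axisymmetric, bounded swirl) OR Case B (locally uniform slice-wise
  limit of a zoom along receding axes, part XV) is constant in space — «the template's non-trivial inner object exists only
  if (AX-L) fails»;
* `innerLimit_curl_eq_zero_under_axisymmetricLiouville` — and then it carries no vorticity (type (α)).

**Nothing here asserts that (AX-L) holds or fails, or that any blow-up / inner object exists.** «violates: n/a — dictionary;
records the conjecture instance ¬(AX-L) by decl»; bears_on LADDER-NS N5/Z1 → N1 linear core / N0⁻ ((I-4)/(I-5)).
Author: ns-blowup-profile-eng-1 g7, 2026-08-27.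
-/

open Real Filter Topology Set MeasureTheory Function
open Literature.Analysis.FluidPDE

namespace Summit.NavierStokesRegularity.OSWSelfSimilar
namespace TypeIIModulationDictionary

section Dichotomy

/-- **Axisymmetry is closed under pointwise limits**: if every `V n` is axisymmetric and `V n y → W y` for every `y`,
then `W` is axisymmetric (each `R_θ` is continuous). The Case-A inner object of (I-3) — a zoom with centres ON the axis,
whose slices are axisymmetric — is therefore axisymmetric. [new here — dictionary] -/
theorem isAxisymmetric_of_tendsto {V : ℕ → EuclideanSpace ℝ (Fin 3) → EuclideanSpace ℝ (Fin 3)}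
    {W : EuclideanSpace ℝ (Fin 3) → EuclideanSpace ℝ (Fin 3)} (hV : ∀ᶠ n in atTop, IsAxisymmetric (V n))
    (hlim : ∀ y, Tendsto (fun n => V n y) atTop (𝓝 (W y))) : IsAxisymmetric W := by
  intro θ y
  have h1 : Tendsto (fun n => V n (rotZ θ y)) atTop (𝓝 (W (rotZ θ y))) := hlim _
  have h2 : Tendsto (fun n => rotZ θ (V n y)) atTop (𝓝 (rotZ θ (W y))) := by
    have hc : Continuous (rotZ θ) := (rotZL θ).continuous.congr fun x => rotZL_apply θ x
    exact (hc.tendsto _).comp (hlim y)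
  exact tendsto_nhds_unique (h1.congr' (hV.mono fun n hn => hn θ y)) h2

variable {W : ℝ → EuclideanSpace ℝ (Fin 3) → EuclideanSpace ℝ (Fin 3)}

/-- **IF (AX-L) holds, a Case-A inner object is constant in space.** Let `W` be a KNSS blow-up limit (`IsKNSSBlowupLimit`:
smooth bounded ancient mild solution in the duality class, `|W| ≤ 1 = sup`) which is axisymmetric on every slice with
bounded swirl (parts XI/XII: the bound `‖Γ₀‖_∞` survives the limit). If the conjecture
`Summit.NavierStokesRegularity.NavierStokesRegularity.AxisymmetricLiouvilleBoundedSwirl` holds, then `W(s, x) = W(s, 0)`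
for all `s < 0` (the conjecture gives a.e.-constant slices; smooth slices are then constant). [new here — dictionary] -/
theorem innerLimit_apply_eq_of_axisymmetricLiouville
    (hAXL : Summit.NavierStokesRegularity.NavierStokesRegularity.AxisymmetricLiouvilleBoundedSwirl)
    (hW : IsKNSSBlowupLimit W) (hax : ∀ s < 0, IsAxisymmetric (W s))
    (hsw : ∃ C : ℝ, ∀ s < 0, ∀ x, |swirl (W s) x| ≤ C) :
    ∀ s < 0, ∀ x : EuclideanSpace ℝ (Fin 3), W s x = W s 0 := by
  intro s hs x
  obtain ⟨b, hb⟩ := hAXL W hW.isBoundedAncientMildSolution hW.aestronglyMeasurable hax hsw s hs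
  have hc : Continuous (W s) := continuous_slice_of_continuousOn_Iio hW.smooth.continuousOn hs
  have e := Measure.eq_of_ae_eq hb hc continuous_const
  rw [congr_fun e x, congr_fun e 0]

/-- **The census sentence by decl: a type-(β) inner object REFUTES (AX-L).** A KNSS blow-up limit which is axisymmetric
with bounded swirl on every slice and has ONE non-constant slice is a counterexample to
`Summit.NavierStokesRegularity.NavierStokesRegularity.AxisymmetricLiouvilleBoundedSwirl` — TEMPLATE (I-4)(β)'s
«violates: ¬(AX-L)» as a kernel implication. [new here — dictionary] -/
theorem not_axisymmetricLiouville_of_innerLimit_typeBeta (hW : IsKNSSBlowupLimit W)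
    (hax : ∀ s < 0, IsAxisymmetric (W s)) (hsw : ∃ C : ℝ, ∀ s < 0, ∀ x, |swirl (W s) x| ≤ C)
    (hnc : ∃ s < 0, ∃ x : EuclideanSpace ℝ (Fin 3), W s x ≠ W s 0) :
    ¬ Summit.NavierStokesRegularity.NavierStokesRegularity.AxisymmetricLiouvilleBoundedSwirl := by
  intro hAXL
  obtain ⟨s, hs, x, hx⟩ := hnc
  exact hx (innerLimit_apply_eq_of_axisymmetricLiouville hAXL hW hax hsw s hs x)

/-- **The (I-3)/(I-4) dichotomy closed under the conjecture.** IF (AX-L) holds, then every KNSS blow-up limit which is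
EITHER a Case-A object (axisymmetric slices with bounded swirl) OR a Case-B object (the locally uniform slice-wise limit of
a zoom whose slices are axisymmetric about vertical axes through `−M_k e₀`, `M_k → ∞` — part XV) is constant in space
on every slice: «the template's non-trivial inner object exists only if (AX-L) fails». Case B needs no conjecture
(`knssBlowupLimit_apply_eq_of_receding_axis`). [new here — dictionary] -/
theorem innerLimit_apply_eq_under_axisymmetricLiouville
    (hAXL : Summit.NavierStokesRegularity.NavierStokesRegularity.AxisymmetricLiouvilleBoundedSwirl)
    (hW : IsKNSSBlowupLimit W)
    (hcase : ((∀ s < 0, IsAxisymmetric (W s)) ∧ ∃ C : ℝ, ∀ s < 0, ∀ x, |swirl (W s) x| ≤ C) ∨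
      ∃ (M : ℕ → ℝ) (V : ℕ → ℝ → EuclideanSpace ℝ (Fin 3) → EuclideanSpace ℝ (Fin 3)),
        Tendsto M atTop atTop ∧
        (∀ k, ∀ s < 0, ∀ (θ : ℝ) (y : EuclideanSpace ℝ (Fin 3)),
          V k s (EuclideanSpace.single 0 (-M k) + rotZ θ (y - EuclideanSpace.single 0 (-M k))) = rotZ θ (V k s y)) ∧
        ∀ s < 0, TendstoLocallyUniformly (fun k => V k s) (W s) atTop) :
    ∀ s < 0, ∀ x : EuclideanSpace ℝ (Fin 3), W s x = W s 0 := by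
  rcases hcase with ⟨hax, hsw⟩ | ⟨M, V, hM, hsym, hconv⟩
  · exact innerLimit_apply_eq_of_axisymmetricLiouville hAXL hW hax hsw
  · exact knssBlowupLimit_apply_eq_of_receding_axis hM hsym hconv hW

/-- **… and then the inner object carries no vorticity** (type (I-4)(α)): under (AX-L), in either case of (I-3),
`curl W(s) ≡ 0`. [new here — dictionary] -/
theorem innerLimit_curl_eq_zero_under_axisymmetricLiouville
    (hAXL : Summit.NavierStokesRegularity.NavierStokesRegularity.AxisymmetricLiouvilleBoundedSwirl)
    (hW : IsKNSSBlowupLimit W)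
    (hcase : ((∀ s < 0, IsAxisymmetric (W s)) ∧ ∃ C : ℝ, ∀ s < 0, ∀ x, |swirl (W s) x| ≤ C) ∨
      ∃ (M : ℕ → ℝ) (V : ℕ → ℝ → EuclideanSpace ℝ (Fin 3) → EuclideanSpace ℝ (Fin 3)),
        Tendsto M atTop atTop ∧
        (∀ k, ∀ s < 0, ∀ (θ : ℝ) (y : EuclideanSpace ℝ (Fin 3)),
          V k s (EuclideanSpace.single 0 (-M k) + rotZ θ (y - EuclideanSpace.single 0 (-M k))) = rotZ θ (V k s y)) ∧
        ∀ s < 0, TendstoLocallyUniformly (fun k => V k s) (W s) atTop) :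
    ∀ s < 0, ∀ y : EuclideanSpace ℝ (Fin 3), curl (W s) y = 0 := by
  intro s hs y
  have hc : W s = fun _ => W s 0 :=
    funext (innerLimit_apply_eq_under_axisymmetricLiouville hAXL hW hcase s hs)
  rw [hc, curl_eq_curlCLM, fderiv_const_apply, map_zero]

end Dichotomy

end TypeIIModulationDictionary
end Summit.NavierStokesRegularity.OSWSelfSimilar
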